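import Mathlib
import Literature.AlgebraicGeometry.Resolution.CobordantGame
import Summits.ResolutionOfSingularities.ResolutionOfSingularities.Theorems.WeightedInvariantGlobalizeLocalDropCanonize
import Summits.ResolutionOfSingularities.ResolutionOfSingularities.Theorems.WeightedInvariantGlobalizeLocalDropCylinder
import Summits.ResolutionOfSingularities.ResolutionOfSingularities.Theorems.WeightedInvariantGlobalizeLocalDropRegularGerms

/-!
# The monomial endgame: a unit times a monomial is won

Crux `LocalWeightedDrop` (stmt-ResolutionOfSingularities-8899, route
ResolutionOfSingularities/WeightedInvariant), line `hasse-ridge-face-selection`, registered stub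
`stub_monomialWon` of the skeleton `LocalWeightedDrop`: in every embedding dimension `n + 1 ≥ 1`
and over every field `k`, for a unit `u` (`u(0) ≠ 0`) and any exponents `e`, the germ
`u · ∏ᵢ xᵢ^{eᵢ}` is in the winning region `CobordantGame.Won` of the local weighted resolution
game.  This is the terminal position of every resolution-driven strategy (simple normal crossings
means locally monomial).

Proof.  Write the monomial as `monomial D 1` (`prod_X_pow_eq_monomial`) and induct on its total
degree `deg D = ∑ᵢ Dᵢ` (`won_unit_mul_monomial`).
* If `D = 0` the germ is the unit `u`, won with value `0` (`wonBy_zero_of_constantCoeff_ne_zero`).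
* Otherwise pick a slot `i` with `Dᵢ ≠ 0`.  Units do not matter (`won_unit_mul_iff`), so we win
  `monomial D 1` by the divisorial move `θ = id`, `w = eᵢ` (`isMove_X_single`).  An exceptional
  point `c` off the vertex has `cᵢ ≠ 0` (the only positive weight is at `i`), and the transform
  there is, by multiplicativity of substitution (`MvPowerSeries.subst_monomial`),
  `∏ⱼ chartⱼ^{Dⱼ} = s^{Dᵢ} · ((cᵢ + yᵢ)^{Dᵢ} · monomial D' 1)` with the exponent
  `D' = ∑_{j ≠ i} Dⱼ [yⱼ]` of total degree `deg D - Dᵢ < deg D`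
  (`subst_cruxChart_single_monomial`, `degree_succExponent_le`).  The cofactor
  `G = (cᵢ + yᵢ)^{Dᵢ} · monomial D' 1` is a unit times a monomial not involving `s`, so `s ∤ G`
  (`not_X_dvd_unit_mul_monomial`: its coefficient at `D'` is the constant term `cᵢ^{Dᵢ} ≠ 0` of
  the unit), hence by uniqueness of the `s`-adic factorisation (`X_pow_mul_eq_X_pow_mul`) every
  `s`-saturated successor at `c` IS `G`, which is won by the induction hypothesis (in one more
  ambient variable).
-/

set_option linter.dupNamespace false -- mandated namespace of this single-conjunct summit

namespace Summit.ResolutionOfSingularities.ResolutionOfSingularities.Theorems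

open Literature.AlgebraicGeometry.Resolution
open Literature.AlgebraicGeometry.Resolution.CobordantGame

namespace MonomialWon

variable {k : Type} [Field k]

/-- A product of powers of the variables is the monomial with the corresponding exponent. -/
theorem prod_X_pow_eq_monomial {m : ℕ} (e : Fin m → ℕ) :
    ∏ i, (MvPowerSeries.X i : MvPowerSeries (Fin m) k) ^ (e i) =
      MvPowerSeries.monomial (Finsupp.equivFunOnFinite.symm e) (1 : k) := by
  have hsum : ∑ i, Finsupp.single i (e i) = Finsupp.equivFunOnFinite.symm e := by
    ext j
    rw [Finsupp.finsetSum_apply, Finsupp.coe_equivFunOnFinite_symm]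
    simp [Finsupp.single_apply]
  simp_rw [MvPowerSeries.X_pow_eq]
  rw [MvPowerSeries.prod_monomial, Finset.prod_const_one, hsum]

/-- A unit times a monomial not involving `x₀` is not divisible by `x₀`: its coefficient at the
monomial's own exponent is the constant term of the unit. -/
theorem not_X_dvd_unit_mul_monomial {m : ℕ} {v : MvPowerSeries (Fin (m + 1)) k}
    (hv : MvPowerSeries.constantCoeff v ≠ 0) {D : Fin (m + 1) →₀ ℕ} (hD : D 0 = 0) :
    ¬ MvPowerSeries.X 0 ∣ v * MvPowerSeries.monomial D (1 : k) := by
  intro h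
  have h1 := MvPowerSeries.X_dvd_iff.mp h D hD
  rw [MvPowerSeries.coeff_mul_monomial, if_pos le_rfl, tsub_self,
    MvPowerSeries.coeff_zero_eq_constantCoeff_apply, mul_one] at h1
  exact hv h1

/-- The crux chart of the divisorial move `w = eᵢ` in the slot `i`: `xᵢ ↦ s · (cᵢ + yᵢ)`. -/
theorem cruxChart_single_self {n : ℕ} (i : Fin n) (c : Fin n → k) :
    cruxChart k (Pi.single i 1) c i =
      MvPowerSeries.X 0 * (MvPowerSeries.C (c i) + MvPowerSeries.X i.succ) := by
  unfold cruxChart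
  rw [Pi.single_eq_same, if_pos Nat.one_pos, pow_one]

/-- The crux chart of the divisorial move `w = eᵢ` off the slot `i`: `xⱼ ↦ yⱼ`. -/
theorem cruxChart_single_of_ne {n : ℕ} {i j : Fin n} (h : j ≠ i) (c : Fin n → k) :
    cruxChart k (Pi.single i 1) c j = MvPowerSeries.X j.succ := by
  unfold cruxChart
  rw [Pi.single_eq_of_ne h, if_neg (lt_irrefl 0)]

/-- THE TRANSFORM OF A MONOMIAL under the divisorial move `(X, eᵢ)` at the exceptional point
`c`: `∏ⱼ chartⱼ^{Dⱼ} = s^{Dᵢ} · ((cᵢ + yᵢ)^{Dᵢ} · ∏_{j ≠ i} yⱼ^{Dⱼ})`, the last product being the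
monomial with exponent `D' = ∑_{j ≠ i} Dⱼ [yⱼ]` (one occurring variable fewer, in one more
ambient variable). -/
theorem subst_cruxChart_single_monomial {n : ℕ} (i : Fin (n + 1)) (c : Fin (n + 1) → k)
    (D : Fin (n + 1) →₀ ℕ) :
    MvPowerSeries.subst (cruxChart k (Pi.single i 1) c) (MvPowerSeries.monomial D (1 : k)) =
      MvPowerSeries.X 0 ^ (D i) * ((MvPowerSeries.C (c i) + MvPowerSeries.X i.succ) ^ (D i) *
        MvPowerSeries.monomial (∑ j ∈ Finset.univ.erase i, Finsupp.single j.succ (D j))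
          (1 : k)) := by
  have hcs : MvPowerSeries.HasSubst (cruxChart k (Pi.single i 1) c) :=
    MvPowerSeries.hasSubst_of_constantCoeff_zero
      (constantCoeff_cruxChart (k := k) (Pi.single i 1) c)
  have hprod : ∏ j ∈ Finset.univ.erase i, cruxChart k (Pi.single i 1) c j ^ (D j) =
      ∏ j ∈ Finset.univ.erase i,
        MvPowerSeries.monomial (Finsupp.single j.succ (D j)) (1 : k) :=
    Finset.prod_congr rfl fun j hj => by
      rw [cruxChart_single_of_ne (Finset.ne_of_mem_erase hj), MvPowerSeries.X_pow_eq]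
  rw [MvPowerSeries.subst_monomial hcs, map_one, one_mul, Finsupp.prod_pow,
    ← Finset.mul_prod_erase Finset.univ (fun j => cruxChart k (Pi.single i 1) c j ^ (D j))
      (Finset.mem_univ i),
    hprod, MvPowerSeries.prod_monomial, Finset.prod_const_one, cruxChart_single_self, mul_pow,
    mul_assoc]

/-- The exponent `D'` of the successor monomial does not involve the exceptional variable `s`. -/
theorem succExponent_zero {n : ℕ} (i : Fin (n + 1)) (D : Fin (n + 1) →₀ ℕ) :
    (∑ j ∈ Finset.univ.erase i, Finsupp.single j.succ (D j)) 0 = 0 := by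
  rw [Finsupp.finsetSum_apply]
  exact Finset.sum_eq_zero fun j _ => Finsupp.single_eq_of_ne (Fin.succ_ne_zero j).symm

/-- The exponent `D'` of the successor monomial has total degree `deg D - Dᵢ`, so `≤ s` when
`deg D ≤ s + 1` and `Dᵢ ≠ 0`. -/
theorem degree_succExponent_le {n s : ℕ} (i : Fin (n + 1)) (D : Fin (n + 1) →₀ ℕ)
    (hD : D.degree ≤ s + 1) (hi : D i ≠ 0) :
    (∑ j ∈ Finset.univ.erase i, Finsupp.single j.succ (D j)).degree ≤ s := by
  have h : D i + (∑ j ∈ Finset.univ.erase i, Finsupp.single j.succ (D j)).degree = D.degree := by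
    rw [map_sum, Finsupp.degree_eq_sum D,
      ← Finset.add_sum_erase Finset.univ (⇑D) (Finset.mem_univ i)]
    simp only [Finsupp.degree_single]
  omega

/-- A unit (times the trivial monomial) is won: it has value `0`. -/
theorem won_unit_mul_monomial_zero {n : ℕ} (u : MvPowerSeries (Fin (n + 1)) k)
    (hu : MvPowerSeries.constantCoeff u ≠ 0) :
    Won k (n + 1) (u * MvPowerSeries.monomial (0 : Fin (n + 1) →₀ ℕ) (1 : k)) := by
  rw [MvPowerSeries.monomial_zero_one, mul_one]
  exact (wonBy_zero_of_constantCoeff_ne_zero (Nat.succ_pos n) hu).won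

/-- INDUCTION ON THE TOTAL DEGREE: in every dimension `n + 1 ≥ 1`, a unit times a monomial of
total degree `≤ s` is won — blow up the divisor of one occurring variable with weight `1`; every
`s`-saturated successor is a unit times a monomial of smaller total degree in one more variable. -/
theorem won_unit_mul_monomial (s : ℕ) : ∀ {n : ℕ} (D : Fin (n + 1) →₀ ℕ), D.degree ≤ s →
    ∀ (u : MvPowerSeries (Fin (n + 1)) k), MvPowerSeries.constantCoeff u ≠ 0 →
    Won k (n + 1) (u * MvPowerSeries.monomial D (1 : k)) := by
  induction s with
  | zero =>
    intro n D hD u hu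
    have hD0 : D = 0 := (Finsupp.degree_eq_zero_iff D).mp (Nat.le_zero.mp hD)
    subst hD0
    exact won_unit_mul_monomial_zero u hu
  | succ s ih =>
    intro n D hD u hu
    by_cases hD0 : D = 0
    · subst hD0
      exact won_unit_mul_monomial_zero u hu
    obtain ⟨i, hi⟩ : ∃ i, D i ≠ 0 := by
      by_contra! hcon
      exact hD0 (Finsupp.ext hcon)
    rw [won_unit_mul_iff hu]
    refine Won.move MvPowerSeries.X (Pi.single i 1) (isMove_X_single i) ?_
    rintro g ⟨c, a, ⟨i', hwi', hci'⟩, hfac, hndvd, -⟩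
    -- the exceptional point is off the vertex in the slot `i` (the only positive weight)
    have hii : i' = i := by
      by_contra h
      rw [Pi.single_eq_of_ne h] at hwi'
      exact lt_irrefl 0 hwi'
    rw [hii] at hci'
    -- the cofactor `G = (cᵢ + yᵢ)^{Dᵢ} · monomial D' 1` of `s^{Dᵢ}` in the transform
    have hv0 : MvPowerSeries.constantCoeff
        ((MvPowerSeries.C (c i) + MvPowerSeries.X i.succ) ^ (D i) :
          MvPowerSeries (Fin (n + 1 + 1)) k) ≠ 0 := by
      rw [map_pow, map_add, MvPowerSeries.constantCoeff_C, MvPowerSeries.constantCoeff_X,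
        add_zero]
      exact pow_ne_zero _ hci'
    have hT := subst_cruxChart_single_monomial i c D
    rw [MvPowerSeries.subst_self, id] at hfac
    -- the successor is `G`, by uniqueness of the `s`-adic factorisation
    obtain ⟨-, rfl⟩ := X_pow_mul_eq_X_pow_mul 0 (hfac.symm.trans hT) hndvd
      (not_X_dvd_unit_mul_monomial hv0 (succExponent_zero i D))
    exact ih _ (degree_succExponent_le i D hD hi) _ hv0

end MonomialWon

/-- MONOMIAL ENDGAME (every dimension, every field): a unit times a monomial `∏ xᵢ^{eᵢ}` is WON —
blow up the divisor of one occurring variable (weight `1` on it, `0` elsewhere): the `s`-saturated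
successor is again a unit times a monomial with smaller total degree (in one more ambient
variable), induction.  This is the terminal position of every resolution-driven strategy (simple
normal crossings ⇒ locally monomial). -/
theorem stub_monomialWon : ∀ (k : Type) [Field k] (n : ℕ) (u : MvPowerSeries (Fin (n + 1)) k) (e : Fin (n + 1) → ℕ),
    MvPowerSeries.constantCoeff u ≠ 0 → CobordantGame.Won k (n + 1) (u * ∏ i, MvPowerSeries.X i ^ (e i)) := by
  intro k _ n u e hu
  rw [MonomialWon.prod_X_pow_eq_monomial e]
  exact MonomialWon.won_unit_mul_monomial _ (Finsupp.equivFunOnFinite.symm e) le_rfl u hu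

end Summit.ResolutionOfSingularities.ResolutionOfSingularities.Theorems
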